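import Summits.PneNP.PneNP.Theorems.PhaseTwinsMacroscopicTwinsAboveDefs
import Literature.ModelTheory.FiniteModelTheory.SparseOrData

/-!
# Route PhaseTwins, crux `MacroscopicTwinsAbove` (stmt-PneNP-2720): the far 3-XOR systems (stub S2)

Stub `stub_farSystems` of the line `literal-gadgets-cfi-apparatus` for the crux
`PhaseTwins.MacroscopicTwinsAbove` (vocabulary of `PhaseTwinsMacroscopicTwinsAboveDefs`): there are constants
`D = 48` (occurrence colours), `c = 4` and `η = 1/16` such that for every radius `s` there is a 3-XOR system
`E : Fin m → Fin 3 → Fin nv` with three distinct variables per equation, `0 < nv ≤ m ≤ 4 nv`, an occurrence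
colouring `loc : Fin m × Fin 3 → Fin 48` injective on the occurrences of each variable, `(s, 1/2)`-boundary
expansion `|T| ≤ 2 |∂T|` for `|T| ≤ s` (`∂ = XorSystem.boundary (lgScope E)`), and a right-hand side `b` such
that every assignment violates at least `t ≥ m / 16` equations.

The proof re-runs the first half of `SparseOrData.exists_data` (all ingredients are PROVED in
`Literature/ModelTheory/FiniteModelTheory/SparseOrData.lean` and `AtseriasDawar3XorProofs.lean`): the
three-uniform vertex expander of `Xor3Gap.exists_threeUniformExpander` on `192 τ` variables and `768 τ`
equations (`s · 1728⁴ ≤ 192 τ`), split into blocks of `48` occurrences (`SparseOrData.splitScope`, which keeps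
the scopes three-element and the expansion, `192 τ ≤ nv ≤ 240 τ`), the boundary bound
`Xor3Gap.card_le_two_mul_card_boundary`, and a far right-hand side from `SparseOrData.exists_far` with the
numerics `SparseOrData.far_ineq` (`48 τ + 1 ≥ 768 τ / 16` violated equations).  Then the variables are
transported to `Fin nv` (`Fintype.equivFin`), every scope is enumerated increasingly (`Finset.orderEmbOfFin`,
so `lgScope E` IS the scope function) and the occurrence `(e, i)` is coloured by the rank of `e` among the
scopes containing `E e i` (`SparseOrData.rank`, injective on the occurrences of a variable by
`SparseOrData.rank_injOn`, and `< 48` because the scope itself is not counted).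
-/

noncomputable section

open scoped Classical BigOperators

namespace Summit.PneNP.PneNP.Cruxes.MacroscopicTwinsAbove.LiteralGadgetsCfiApparatus

open Finset
open Literature.ModelTheory.FiniteModelTheory (XorSystem.boundary SparseOrData.rank SparseOrData.rank_injOn
  SparseOrData.SplitVar SparseOrData.splitScope SparseOrData.card_splitScope SparseOrData.splitDeg_le
  SparseOrData.card_biUnion_le_card_biUnion_split SparseOrData.card_splitVar_le SparseOrData.le_card_splitVar
  SparseOrData.exists_far SparseOrData.far_ineq Xor3Gap.exists_threeUniformExpander
  Xor3Gap.card_le_two_mul_card_boundary)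

-- `Summit.PneNP.PneNP.…` (summit = sub-problem name) trips the duplicate-namespace linter on every declaration.
set_option linter.dupNamespace false

variable {nv m v P κ₁ D K : ℕ}

/-! ## Enumerating the scopes and colouring the occurrences -/

/-- The rank of a scope at one of ITS OWN variables is smaller than the number of scopes containing the
variable (the scope itself is not counted among the earlier ones). -/
theorem rank_lt_card_filter (S' : Fin m → Finset (Fin nv)) {u : Fin m} {x : Fin nv} (hx : x ∈ S' u) :
    SparseOrData.rank S' u x < (univ.filter fun u' => x ∈ S' u').card := by
  unfold SparseOrData.rank
  exact Finset.card_lt_card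
    (Finset.filter_ssubset.2 ⟨u, Finset.mem_filter.2 ⟨Finset.mem_univ _, hx⟩, lt_irrefl u⟩)

/-- **Enumeration of a three-uniform system of scopes on `Fin nv`.** Listing every scope increasingly
(`Finset.orderEmbOfFin`) gives `E e : Fin 3 → Fin nv` injective with `lgScope E = S'` (so the sum over the
three positions of an equation is the sum over its scope), and colouring the occurrence `(e, i)` by the rank
of `e` among the scopes containing `E e i` (`SparseOrData.rank`, `< D` when every variable lies in at most
`D` scopes) is injective on the occurrences of each variable (`SparseOrData.rank_injOn`). -/
theorem exists_enum (S' : Fin m → Finset (Fin nv)) (h3 : ∀ e, (S' e).card = 3)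
    (hdeg : ∀ x : Fin nv, (univ.filter fun e => x ∈ S' e).card ≤ D) :
    ∃ (E : Fin m → Fin 3 → Fin nv) (loc : Fin m × Fin 3 → Fin D),
      (∀ e, Function.Injective (E e)) ∧ lgScope E = S' ∧
      (∀ p p' : Fin m × Fin 3, E p.1 p.2 = E p'.1 p'.2 → loc p = loc p' → p = p') ∧
      ∀ (f : Fin nv → ZMod 2) (e : Fin m), ∑ i : Fin 3, f (E e i) = ∑ x ∈ S' e, f x := by
  obtain ⟨E, hE'⟩ : ∃ E : Fin m → Fin 3 → Fin nv, ∀ e, E e = ⇑((S' e).orderEmbOfFin (h3 e)) :=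
    ⟨_, fun e => rfl⟩
  have hE : ∀ e, Function.Injective (E e) := fun e => by
    rw [hE' e]; exact ((S' e).orderEmbOfFin (h3 e)).injective
  have hmem : ∀ e i, E e i ∈ S' e := fun e i => by
    rw [hE' e]; exact Finset.orderEmbOfFin_mem _ _ i
  have hscope : lgScope E = S' := funext fun e => by
    unfold lgScope
    rw [hE' e]
    exact Finset.image_orderEmbOfFin_univ _ _
  have hlt : ∀ p : Fin m × Fin 3, SparseOrData.rank S' p.1 (E p.1 p.2) < D := fun p =>
    (rank_lt_card_filter S' (hmem p.1 p.2)).trans_le (hdeg _)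
  refine ⟨E, fun p => ⟨SparseOrData.rank S' p.1 (E p.1 p.2), hlt p⟩, hE, hscope, ?_, fun f e => ?_⟩
  · intro p p' hEq hloc
    have hr : SparseOrData.rank S' p.1 (E p.1 p.2) = SparseOrData.rank S' p'.1 (E p'.1 p'.2) :=
      congrArg Fin.val hloc
    have h1 : p.1 = p'.1 := by
      refine SparseOrData.rank_injOn S' (E p.1 p.2) (hmem p.1 p.2) ?_ ?_
      · rw [hEq]; exact hmem p'.1 p'.2
      · rw [hr, hEq]
    have h2 : p.2 = p'.2 := by
      refine hE p.1 ?_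
      rw [hEq, h1]
    exact Prod.ext h1 h2
  · have h := congrFun hscope e
    unfold lgScope at h
    rw [← h, Finset.sum_image (hE e).injOn]

/-- **Transport to `Fin nv`.** A three-uniform system of scopes on a finite variable set `V` with every
variable in at most `D` scopes, vertex expansion `7|T| ≤ 4|N(T)|` for `|T| ≤ s` and a right-hand side
violated at least `t` times by every assignment yields, on the variables `Fin (card V)`, the data of
`stub_farSystems`: injective `E e`, an occurrence colouring injective on the occurrences of each variable,
`(s, 1/2)`-boundary expansion of `lgScope E` (`Xor3Gap.card_le_two_mul_card_boundary`) and `t`-farness. -/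
theorem exists_system_fin {V : Type*} [Fintype V] [DecidableEq V] {s t : ℕ} (S : Fin m → Finset V)
    (hS3 : ∀ u, (S u).card = 3) (hdeg : ∀ y : V, (univ.filter fun u => y ∈ S u).card ≤ D)
    (hexp : ∀ T : Finset (Fin m), T.card ≤ s → 7 * T.card ≤ 4 * (T.biUnion S).card)
    (b : Fin m → ZMod 2)
    (hfar : ∀ x : V → ZMod 2, t ≤ (univ.filter fun u => ∑ y ∈ S u, x y ≠ b u).card) :
    ∃ (E : Fin m → Fin 3 → Fin (Fintype.card V)) (loc : Fin m × Fin 3 → Fin D),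
      (∀ e, Function.Injective (E e)) ∧
      (∀ p p' : Fin m × Fin 3, E p.1 p.2 = E p'.1 p'.2 → loc p = loc p' → p = p') ∧
      (∀ T : Finset (Fin m), T.card ≤ s → T.card ≤ 2 * (XorSystem.boundary (lgScope E) T).card) ∧
      ∀ f : Fin (Fintype.card V) → ZMod 2,
        t ≤ (univ.filter fun e : Fin m => ∑ i : Fin 3, f (E e i) ≠ b e).card := by
  set φ : V ≃ Fin (Fintype.card V) := Fintype.equivFin V
  obtain ⟨S', hS'⟩ : ∃ S' : Fin m → Finset (Fin (Fintype.card V)), ∀ u, S' u = (S u).map φ.toEmbedding :=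
    ⟨_, fun u => rfl⟩
  have h3 : ∀ u, (S' u).card = 3 := fun u => by rw [hS' u, Finset.card_map, hS3]
  have hdeg' : ∀ z, (univ.filter fun u => z ∈ S' u).card ≤ D := fun z => by
    have h : (univ.filter fun u => z ∈ S' u) = univ.filter fun u => φ.symm z ∈ S u :=
      Finset.filter_congr fun u _ => by rw [hS' u, Finset.mem_map_equiv]
    rw [h]
    exact hdeg (φ.symm z)
  obtain ⟨E, loc, hE, hscope, hloc, hsum⟩ := exists_enum S' h3 hdeg'
  refine ⟨E, loc, hE, hloc, fun T hT => ?_, fun f => ?_⟩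
  · rw [hscope]
    refine Xor3Gap.card_le_two_mul_card_boundary S' T (fun u _ => h3 u) ((hexp T hT).trans ?_)
    refine Nat.mul_le_mul_left 4 (le_of_eq ?_)
    have hb : T.biUnion S' = (T.biUnion S).map φ.toEmbedding := by
      ext z
      simp only [Finset.mem_biUnion, Finset.mem_map_equiv, hS']
    rw [hb, Finset.card_map]
  · have hset : (univ.filter fun e : Fin m => ∑ i : Fin 3, f (E e i) ≠ b e) =
        univ.filter fun u => ∑ y ∈ S u, (f ∘ φ) y ≠ b u := by
      refine Finset.filter_congr fun u _ => ?_
      rw [hsum f u, hS' u, Finset.sum_map]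
      rfl
    rw [hset]
    exact hfar (f ∘ φ)

/-! ## The stub -/

/-- **S2 — far-from-satisfiable, boundary-expanding, bounded-occurrence 3-XOR systems for every radius `s`.**
There are constants `D = 48` (occurrence colours), `c = 4` (`m ≤ c·nv`) and `η = 1/16 > 0` such that for
every `s` there is a system of `m` equations `x_{E e 0} + x_{E e 1} + x_{E e 2} = b e` on `nv ≥ 1` variables
with three DISTINCT variables per equation, `nv ≤ m ≤ c·nv`, a labelling `loc` of the occurrences injective
on the occurrences of each variable, `(s, 1/2)`-boundary expansion `|T| ≤ 2|∂T|` for `|T| ≤ s`, and a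
right-hand side `b` that is `t`-far with `t ≥ η m`.  Proof: the first half of `SparseOrData.exists_data`
with `τ = 1728⁴ (s + 1)` — `Xor3Gap.exists_threeUniformExpander` (`192τ` variables, `768τ` three-element
scopes, `7|T| ≤ 4|N(T)|` for `|T| ≤ s`), `SparseOrData.splitScope F 48` (occurrence `≤ 48`, expansion kept,
`192τ ≤ nv ≤ 240τ`), `SparseOrData.exists_far` with `far_ineq` (`48τ + 1` violated equations), transported
to `Fin nv` by `exists_system_fin`. -/
theorem stub_farSystems : ∃ (D c : ℕ) (η : ℝ), 0 < η ∧ ∀ s : ℕ,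
    ∃ (nv m t : ℕ) (E : Fin m → Fin 3 → Fin nv) (loc : Fin m × Fin 3 → Fin D) (b : Fin m → ZMod 2),
      0 < nv ∧ nv ≤ m ∧ m ≤ c * nv ∧ (∀ e, Function.Injective (E e)) ∧
      (∀ p p' : Fin m × Fin 3, E p.1 p.2 = E p'.1 p'.2 → loc p = loc p' → p = p') ∧
      (∀ T : Finset (Fin m), T.card ≤ s →
        T.card ≤ 2 * (Literature.ModelTheory.FiniteModelTheory.XorSystem.boundary (lgScope E) T).card) ∧
      η * m ≤ t ∧
      ∀ f : Fin nv → ZMod 2, t ≤ (Finset.univ.filter fun e : Fin m => ∑ i : Fin 3, f (E e i) ≠ b e).card := by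
  refine ⟨48, 4, 1 / 16, by norm_num, fun s => ?_⟩
  -- the size parameter `τ = 1728⁴ (s + 1)`
  obtain ⟨τ, hτ1, hsτ⟩ : ∃ τ : ℕ, 1 ≤ τ ∧ s * (432 * 4) ^ 4 ≤ 192 * τ := by
    refine ⟨(432 * 4) ^ 4 * (s + 1), Nat.succ_le_of_lt (by positivity), ?_⟩
    calc s * (432 * 4) ^ 4 ≤ (s + 1) * (432 * 4) ^ 4 := Nat.mul_le_mul_right _ (Nat.le_succ s)
      _ = 1 * ((432 * 4) ^ 4 * (s + 1)) := by ring
      _ ≤ 192 * ((432 * 4) ^ 4 * (s + 1)) := Nat.mul_le_mul_right _ (by norm_num)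
  -- the three-uniform expander (Atserias–Dawar, by counting)
  obtain ⟨F, hF3, hFexp⟩ := Xor3Gap.exists_threeUniformExpander (n := 192 * τ) (m := 768 * τ) (s := s)
    (c := 4) (by norm_num) (by omega) (by omega) hsτ
  -- split into blocks of `48` occurrences (as in `SparseOrData.exists_data`)
  have hS3 : ∀ u, (SparseOrData.splitScope F 48 u).card = 3 := fun u => by
    rw [SparseOrData.card_splitScope, hF3]
  have hdegS : ∀ x : SparseOrData.SplitVar F 48,
      (univ.filter fun u => x ∈ SparseOrData.splitScope F 48 u).card ≤ 48 :=
    fun x => SparseOrData.splitDeg_le F 48 (by norm_num) x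
  have hcardV : Fintype.card (SparseOrData.SplitVar F 48) ≤ 240 * τ := by
    have h := SparseOrData.card_splitVar_le F 48 (by norm_num : 0 < 48)
    have hsum : ∑ u, (F u).card = 3 * (768 * τ) := by
      rw [Finset.sum_congr rfl fun u _ => hF3 u, Finset.sum_const, Finset.card_univ, Fintype.card_fin,
        smul_eq_mul, mul_comm]
    rw [hsum] at h
    omega
  have hcardV' : 192 * τ ≤ Fintype.card (SparseOrData.SplitVar F 48) := SparseOrData.le_card_splitVar F 48
  have hexpS : ∀ T : Finset (Fin (768 * τ)), T.card ≤ s →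
      7 * T.card ≤ 4 * (T.biUnion (SparseOrData.splitScope F 48)).card := fun T hT =>
    (hFexp T hT).trans (Nat.mul_le_mul_left 4 (SparseOrData.card_biUnion_le_card_biUnion_split F 48 T))
  -- a far right-hand side (first moment, `far_ineq`)
  obtain ⟨b, hb⟩ := SparseOrData.exists_far (p := 2) (SparseOrData.splitScope F 48) (48 * τ + 1)
    (SparseOrData.far_ineq le_rfl hτ1 hcardV)
  -- transport to `Fin nv`, enumerate the scopes, colour the occurrences
  obtain ⟨E, loc, hE, hloc, hbd, hfar⟩ :=
    exists_system_fin (SparseOrData.splitScope F 48) hS3 hdegS hexpS b hb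
  refine ⟨Fintype.card (SparseOrData.SplitVar F 48), 768 * τ, 48 * τ + 1, E, loc, b, by omega, by omega,
    by omega, hE, hloc, hbd, ?_, hfar⟩
  push_cast
  linarith

end Summit.PneNP.PneNP.Cruxes.MacroscopicTwinsAbove.LiteralGadgetsCfiApparatus
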